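import Literature.NumberTheory.LFunctions.TruncatedWeilFormTestFunctionProofs
import Literature.NumberTheory.LFunctions.TruncatedWeilFormTailOrderDensityProofs
import Literature.NumberTheory.LFunctions.TruncatedWeilFormArchSideProofs
import Literature.NumberTheory.LFunctions.WeilExplicitContinuous
import Literature.NumberTheory.LFunctions.WeilZeroSum
import Literature.NumberTheory.LFunctions.ZetaZeroReciprocalSum
import HarnessLib

/-!
# RH-FREE — «nothing here bears on the truth of RH»: the zero side of Groskin's finite Guinand–Weil dictionary (arXiv:2607.02828, Theorem 2.5) from the tree's explicit formula

LINE 1 — LABEL: RH-FREE literature (the Guinand–Weil explicit formula, a THEOREM of the tree,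
applied to one explicit band-limited test function at fixed `(c, N)`; an explicit formula is an
identity valid wherever the zeros of `ζ` are — no positivity statement, no input on their
location). Cell `rh-crit/cc` (surplus seat, Groskin cluster R153), fleet debt on the rung
W-C/W-P (COLUMN 2 WEIL). WHAT THIS IS NOT: any claim about the zeros of `ζ`, Weil positivity or
RH; «the paper does not prove RH, Weil positivity, a prime-location bound» ([Gr26] p. 13), and a
kernel replay of its Theorem 2.5 moves nothing. Nothing here bears on the truth of RH.

Topic `Literature/NumberTheory/LFunctions`; namespace `Literature.NumberTheory.LFunctions.Groskin2026`,
sub-namespace `ZeroSide`. THEOREMS ONLY (no definitions, no named facts). The statements are those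
of the statement file `TruncatedWeilFormTailOrder.lean` ([claim: Groskin2026, status: under-review]
records of an unrefereed preprint, D-0012); a kernel proof VERIFIES them, it asserts nothing on
authority.

## What is proved

[Gr26] Theorem 2.5 (p. 6), ZERO SIDE: `⟨v, Q_∞ v⟩ = Σ_{z ∈ Z*_ζ} g_v(z)` with multiplicity. The
printed proof (p. 6, last paragraph): «The Guinand–Weil explicit formula in the normalization of
Connes, Bombieri, and Connes–Consani–Moscovici [20, 29, 6, 4, 10] states, for every test function in
the class of Lemma 2.2, `Σ_{z∈Z*_ζ} g_v(z) = −(1/π)Σ_{q=p^a} Λ(q)q^{-1/2} ĝ_v(log q/2π) + 2g_v(i/2) +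
(1/2π)∫_ℝ h₊(r)g_v(r)dr`. Since `supp ĝ_v ⊂ [−Δ,Δ] = [−L/(2π), L/(2π)]`, prime powers `q > c` satisfy
`log q/(2π) > Δ` and do not contribute. This identifies the finite form with the zero side.»

We follow it literally, the explicit formula being the tree's
`Literature.NumberTheory.LFunctions.explicit_formula_continuous` (`WeilExplicitContinuous.lean`:
Bombieri 2000, Thm. 2, for continuous compactly supported test functions with absolutely
convergent zero side and integrable archimedean integrand — the class of Balazard–de Roton,
Prop. 11, which contains Groskin's «class of Lemma 2.2»):

* TRANSPORT (`weilMellin_transport`). The tree's test function on the `t`-line is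
  `g(t) = (1/2π) ĝ_v(t/2π)` (supported in `[−L, L]`), and `ĝ(s) = ∫ g(t)e^{(s−½)t}dt =
  g_v((s − ½)/i)` (substitution `t = 2πξ`); in particular `ĝ(ρ) = g_v((ρ − ½)/i)` is the summand
  of `theorem_2_5` verbatim, `ĝ(½ + it) = g_v(t)`, `ĝ(0) + ĝ(1) = 2 g_v(i/2)` (`g_v` is even
  because `ĝ_v` is), `g(log n) + g(−log n) = (1/π) ĝ_v(log n/2π)`, vanishing for `n > c`.
* CONVERGENCE. From [Gr26] Lemma 2.2's strip decay `g_v(z) = O((1+|Re z|)⁻²)` on `|Im z| ≤ ½`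
  (the tree THEOREM `lemma_2_2_holds`, cc-t4 g5, imported BY NAME) and the tree's unconditional
  `Σ_ρ m(ρ)/(1+γ²) < ∞` (`ZetaZeroSum.summable_zeroOrder_div_one_add_sq`): the zero side
  converges absolutely; with `|Re ψ(¼ + it/2)| ≤ A + log(1 + |t|)` (from the tree's h₊ toolkit
  `hPlus_le_log_sub`, `reDigammaQuarter_mono`) the archimedean integrand is integrable and
  `g_v ∈ L¹(ℝ)`.
* ARCHIMEDEAN TERM. `(1/2π)∫ ĝ(½+it) Re ψ(¼+it/2) dt − g(0) log π = (1/2π)∫ h₊(r) g_v(r) dr`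
  because `∫_ℝ g_v = ĝ_v(0)` (Fourier inversion at `0`, Mathlib
  `MeasureTheory.Integrable.fourierInv_fourier_eq`).
* DOOR `Groskin2026.theorem_2_5_of : theorem_2_5' → theorem_2_5`: the explicit formula gives
  `Σ_ρ m(ρ) g_v((ρ−½)/i) = W(g)` (`hasSum_zeros_transport`, unconditional), the three bullets give
  `W(g) =` the right-hand side of `theorem_2_5'` (`weilFunctional_transport`, unconditional), so the
  ZERO side of Theorem 2.5 follows from its SOURCE side (the claim `theorem_2_5'`, taken BY NAME as
  the only hypothesis); and the DISCHARGE `Groskin2026.theorem_2_5_holds : theorem_2_5`, feeding the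
  door with the tree theorem `theorem_2_5'_holds` (cc-t9 g4, `TruncatedWeilFormArchSideProofs.lean`,
  itself over cc-t11 g4's `lemma_2_1_limit_holds`).
  Also recorded: `exists_abs_hPlus_le_log` (`|h₊(r)| ≤ A + B log(2 + |r|)`).

## References

* [Gr26] A. Groskin, arXiv:2607.02828v3 (2026), Theorem 2.5 and its proof, p. 6; Lemma 2.2, p. 4.
  [claim: Groskin2026, status: under-review]
* [Bombieri2000Weil] E. Bombieri, Rend. Mat. Acc. Lincei (9) 11 (2000), Thm. 2 (the explicit
  formula, tree theorem `explicit_formula_holds` / `explicit_formula_continuous`).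
* [BalazardDeRoton2008] M. Balazard, A. de Roton, arXiv:0810.3587, Prop. 11 (the class of test
  functions).
-/

noncomputable section

open Filter Set MeasureTheory Complex Finset Matrix
open scoped Real Topology FourierTransform

namespace Literature.NumberTheory.LFunctions

namespace Groskin2026

namespace ZeroSide

open Literature.Analysis.SpecialFunctions

variable {c : ℝ} {N : ℕ} {v : Fin (N + 1) → ℝ}

/-! ## §1 The Fourier weight `ĝ_v`: support and evenness of `g_v`

(`bandwidth_pos`, `volterraKernel_zero`, `fourierWeight_neg`, `continuous_fourierWeight`,
`differentiable_testFunction`, `lemma_2_2_holds` are cc-t4 g5's, `TruncatedWeilFormTestFunctionProofs.lean`;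
`continuous_volterraKernel` is cc-t9 g4's, `TruncatedWeilFormSourceSideProofs.lean` — imported BY NAME.) -/

/-- `ĝ_v(ξ) = 0` for `|ξ| ≥ Δ` (for `|ξ| = Δ` because `K_v(0) = 0`). [cite: Groskin2026, §2.1 (p. 3)] -/
theorem fourierWeight_eq_zero (hc : 1 < c) {ξ : ℝ} (hξ : bandwidth c ≤ |ξ|) :
    fourierWeight c N v ξ = 0 := by
  unfold fourierWeight
  split_ifs with h
  · have hΔ := bandwidth_pos hc
    have : |ξ| = bandwidth c := le_antisymm h hξ
    rw [this, div_self hΔ.ne', sub_self, volterraKernel_zero, mul_zero]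
  · rfl

/-- The support of `ĝ_v` lies in `(−Δ, Δ]` (indeed in `(−Δ, Δ)`). [cite: Groskin2026, §2.1 (p. 3)] -/
theorem support_fourierWeight_subset (hc : 1 < c) :
    Function.support (fourierWeight c N v) ⊆ Ioc (-bandwidth c) (bandwidth c) := by
  intro ξ hξ
  rw [Function.mem_support] at hξ
  by_contra h
  apply hξ
  apply fourierWeight_eq_zero hc
  rw [Set.mem_Ioc, not_and_or, not_lt, not_le] at h
  rcases h with h | h
  · rw [abs_of_nonpos (by linarith [bandwidth_pos hc])]; linarith
  · exact h.le.trans (le_abs_self ξ)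

/-- The interval integral defining `g_v` is the integral over `ℝ`. [folklore] -/
private theorem testFunction_eq_integral_mul (hc : 1 < c) (z : ℂ) :
    testFunction c N v z = ∫ ξ : ℝ, fourierWeight c N v ξ * cexp (2 * π * I * z * ξ) := by
  unfold testFunction
  apply intervalIntegral.integral_eq_integral_of_support_subset
  intro ξ hξ
  apply support_fourierWeight_subset hc
  rw [Function.mem_support] at hξ ⊢
  intro h
  exact hξ (by rw [h, zero_mul])

/-- `g_v` is even. [cite: Groskin2026, §2.1 (p. 3), «hence g_v is even»] -/
theorem testFunction_neg (hc : 1 < c) (z : ℂ) :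
    testFunction c N v (-z) = testFunction c N v z := by
  rw [testFunction_eq_integral_mul hc, testFunction_eq_integral_mul hc]
  have h := MeasureTheory.Measure.integral_comp_mul_left
    (fun ξ : ℝ ↦ fourierWeight c N v ξ * cexp (2 * π * I * z * ξ)) (-1)
  simp only [neg_mul, one_mul, inv_neg, inv_one, abs_neg, abs_one, one_smul] at h
  rw [← h]
  refine integral_congr_ae (Eventually.of_forall fun ξ ↦ ?_)
  simp only [fourierWeight_neg]
  congr 1
  push_cast
  ring_nf

/-! ## §2 The transported test function `g(t) = (1/2π) ĝ_v(t/2π)` -/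

/-- `g` is continuous. [folklore] -/
private theorem continuous_transport (hc : 1 < c) (N : ℕ) (v : Fin (N + 1) → ℝ) :
    Continuous fun t : ℝ ↦ fourierWeight c N v (t / (2 * π)) / (2 * π) :=
  ((continuous_fourierWeight hc N v).comp (by fun_prop)).div_const _

/-- `g(t) = 0` for `|t| ≥ log c`. [cite: Groskin2026, §2.1 (p. 3)] -/
theorem transport_eq_zero (hc : 1 < c) {t : ℝ} (ht : Real.log c ≤ |t|) :
    fourierWeight c N v (t / (2 * π)) / (2 * π) = 0 := by
  rw [fourierWeight_eq_zero hc, zero_div]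
  rw [abs_div, abs_of_pos (by positivity : (0 : ℝ) < 2 * π), bandwidth]
  exact div_le_div_of_nonneg_right ht (by positivity)

/-- `g` has compact support (in `[−log c, log c]`). [folklore] -/
private theorem hasCompactSupport_transport (hc : 1 < c) (N : ℕ) (v : Fin (N + 1) → ℝ) :
    HasCompactSupport fun t : ℝ ↦ fourierWeight c N v (t / (2 * π)) / (2 * π) := by
  refine HasCompactSupport.intro (isCompact_Icc (a := -Real.log c) (b := Real.log c)) ?_
  intro t ht
  apply transport_eq_zero hc
  rw [Set.mem_Icc, not_and_or, not_le, not_le] at ht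
  rcases ht with h | h
  · rw [abs_of_neg (by linarith [Real.log_pos hc])]; linarith
  · exact h.le.trans (le_abs_self t)

/-- **Transport of the Mellin–Laplace transform**: `ĝ(s) = g_v((s − ½)/i)` for
`g(t) = (1/2π) ĝ_v(t/2π)` (substitution `t = 2πξ`). [cite: Groskin2026, Theorem 2.5 (p. 6)] -/
theorem weilMellin_transport (hc : 1 < c) (N : ℕ) (v : Fin (N + 1) → ℝ) (s : ℂ) :
    weilMellin (fun t : ℝ ↦ fourierWeight c N v (t / (2 * π)) / (2 * π)) s =
      testFunction c N v ((s - 1 / 2) / I) := by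
  have hπ : (2 * π : ℝ) ≠ 0 := by positivity
  unfold weilMellin
  set H : ℝ → ℂ := fun ξ ↦ fourierWeight c N v ξ / (2 * π) * cexp ((s - 1 / 2) * (2 * π * ξ))
    with hH
  have h1 : (fun t : ℝ ↦ fourierWeight c N v (t / (2 * π)) / (2 * π) * cexp ((s - 1 / 2) * t)) =
      fun t : ℝ ↦ H (t / (2 * π)) := by
    funext t
    simp only [hH]
    congr 2
    push_cast
    field_simp
  rw [h1, MeasureTheory.Measure.integral_comp_div H (2 * π), abs_of_pos (by positivity),
    testFunction_eq_integral_mul hc, ← integral_smul]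
  refine integral_congr_ae (Eventually.of_forall fun ξ ↦ ?_)
  have hI : cexp (2 * π * I * ((s - 1 / 2) / I) * ξ) = cexp ((s - 1 / 2) * (2 * π * ξ)) := by
    congr 1
    field_simp
  simp only [hH, Complex.real_smul, hI]
  push_cast
  field_simp

/-- On the critical line: `ĝ(½ + it) = g_v(t)`. [cite: Groskin2026, Theorem 2.5 (p. 6)] -/
theorem weilMellin_transport_half (hc : 1 < c) (N : ℕ) (v : Fin (N + 1) → ℝ) (t : ℝ) :
    weilMellin (fun t : ℝ ↦ fourierWeight c N v (t / (2 * π)) / (2 * π)) (1 / 2 + t * I) =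
      testFunction c N v t := by
  rw [weilMellin_transport hc]
  congr 1
  field_simp
  ring

/-- The polar term: `ĝ(0) + ĝ(1) = 2 g_v(i/2)` (`g_v` even). [cite: Groskin2026, Theorem 2.5 (p. 6), «2 g_v(i/2)»] -/
theorem weilPolarTerm_transport (hc : 1 < c) (N : ℕ) (v : Fin (N + 1) → ℝ) :
    weilPolarTerm (fun t : ℝ ↦ fourierWeight c N v (t / (2 * π)) / (2 * π)) =
      2 * testFunction c N v (I / 2) := by
  unfold weilPolarTerm
  rw [weilMellin_transport hc, weilMellin_transport hc]
  have h0 : ((0 : ℂ) - 1 / 2) / I = I / 2 := by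
    rw [div_eq_iff I_ne_zero]
    ring_nf
    rw [I_sq]
    ring
  have h1 : ((1 : ℂ) - 1 / 2) / I = -(I / 2) := by
    rw [div_eq_iff I_ne_zero]
    ring_nf
    rw [I_sq]
    ring
  rw [h0, h1, testFunction_neg hc]
  ring

/-- The prime term: `Σ_n Λ(n) n^{-½}(g(log n) + g(−log n)) = (1/π) Σ_{q ≤ ⌊c⌋} Λ(q) q^{-½} ĝ_v(log q/2π)`
(`ĝ_v` is even and vanishes at `log n/2π ≥ Δ`, i.e. for `n > c`).
[cite: Groskin2026, Theorem 2.5 (p. 6), «prime powers q > c … do not contribute»] -/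
theorem weilPrimeTerm_transport (hc : 1 < c) (N : ℕ) (v : Fin (N + 1) → ℝ) :
    weilPrimeTerm (fun t : ℝ ↦ fourierWeight c N v (t / (2 * π)) / (2 * π)) =
      (1 / π) * ∑ q ∈ Finset.range (⌊c⌋₊ + 1),
        ((ArithmeticFunction.vonMangoldt q / Real.sqrt q : ℝ) : ℂ) *
          fourierWeight c N v (Real.log q / (2 * π)) := by
  unfold weilPrimeTerm
  have hc0 : 0 < c := by linarith
  -- the summand
  have hterm : ∀ n : ℕ, ((ArithmeticFunction.vonMangoldt n : ℝ) : ℂ) / (Real.sqrt n : ℂ) *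
      (fourierWeight c N v (Real.log n / (2 * π)) / (2 * π) +
        fourierWeight c N v (-Real.log n / (2 * π)) / (2 * π)) =
      (1 / π) * (((ArithmeticFunction.vonMangoldt n / Real.sqrt n : ℝ) : ℂ) *
        fourierWeight c N v (Real.log n / (2 * π))) := by
    intro n
    rw [neg_div, fourierWeight_neg]
    push_cast
    field_simp
    ring
  simp_rw [hterm]
  rw [tsum_mul_left, tsum_eq_sum (s := Finset.range (⌊c⌋₊ + 1))]
  intro n hn
  rw [Finset.mem_range, not_lt] at hn
  have hn1 : c < n := (Nat.lt_floor_add_one c).trans_le (by exact_mod_cast hn)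
  have hlog : Real.log c < Real.log n := Real.log_lt_log hc0 hn1
  rw [fourierWeight_eq_zero hc, mul_zero]
  rw [bandwidth, abs_div, abs_of_pos (by positivity : (0 : ℝ) < 2 * π)]
  exact div_le_div_of_nonneg_right (hlog.le.trans (le_abs_self _)) (by positivity)

/-! ## §3 Growth of `h₊` and of `Re ψ(¼ + it/2)` -/

/-- `|Re ψ(¼ + it/2)| ≤ (|ψ(¼)| + log 7 + log π) + log(1 + |t|)` for every real `t` (from the tree's
monotonicity of `Re ψ(¼ + it/2)` in `|t|` and the upper bound `h₊(t) ≤ log t − 8/5` on `[7,∞)` of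
[Gr26] Lemma 3.1, tree theorem `hPlus_le_log_sub`). [cite: Groskin2026, Lemma 3.1 (p. 9)] -/
theorem abs_reDigammaQuarter_le_log (t : ℝ) :
    |reDigammaQuarter t| ≤
      (|reDigammaQuarter 0| + Real.log 7 + Real.log π) + Real.log (1 + |t|) := by
  have hlow : reDigammaQuarter 0 ≤ reDigammaQuarter t := reDigammaQuarter_zero_le t
  have hlogπ : 0 ≤ Real.log π := Real.log_nonneg (by linarith [Real.pi_gt_three])
  have hlog7 : 0 ≤ Real.log 7 := Real.log_nonneg (by norm_num)
  have hlog1 : 0 ≤ Real.log (1 + |t|) := Real.log_nonneg (by linarith [abs_nonneg t])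
  -- upper bound
  have hup : reDigammaQuarter t ≤ Real.log 7 + Real.log π + Real.log (1 + |t|) := by
    rcases le_or_gt 7 |t| with h7 | h7
    · have h := hPlus_le_log_sub h7
      have he : reDigammaQuarter t = reDigammaQuarter |t| := by
        rcases abs_choice t with h | h
        · rw [h]
        · rw [h, reDigammaQuarter_even]
      unfold hPlus at h
      have hl : Real.log |t| ≤ Real.log (1 + |t|) :=
        Real.log_le_log (by linarith) (by linarith)
      rw [he]
      linarith
    · have hm : reDigammaQuarter t ≤ reDigammaQuarter 7 :=
        reDigammaQuarter_mono (by rw [abs_of_pos (by norm_num : (0 : ℝ) < 7)]; exact h7.le)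
      have h := hPlus_le_log_sub (le_refl (7 : ℝ))
      unfold hPlus at h
      linarith
  rw [abs_le]
  constructor
  · linarith [neg_abs_le (reDigammaQuarter 0)]
  · linarith [abs_nonneg (reDigammaQuarter 0)]

/-- `|h₊(r)| ≤ A + B log(2 + |r|)` with explicit `A, B` — the growth `h₊(r) = O(log(2 + |r|))` quoted
in the printed proof of Theorem 2.5 ([Gr26] p. 6, citing [24]). [cite: Groskin2026, Theorem 2.5 (p. 6)] -/
theorem exists_abs_hPlus_le_log :
    ∃ A B : ℝ, ∀ r : ℝ, |hPlus r| ≤ A + B * Real.log (2 + |r|) := by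
  refine ⟨|reDigammaQuarter 0| + Real.log 7 + 2 * Real.log π, 1, fun r ↦ ?_⟩
  have h := abs_reDigammaQuarter_le_log r
  have hlogπ : 0 ≤ Real.log π := Real.log_nonneg (by linarith [Real.pi_gt_three])
  have hl : Real.log (1 + |r|) ≤ Real.log (2 + |r|) :=
    Real.log_le_log (by linarith [abs_nonneg r]) (by linarith)
  unfold hPlus
  have := abs_sub (reDigammaQuarter r) (Real.log π)
  rw [abs_of_nonneg hlogπ] at this
  linarith

/-! ## §4 Convergence from the strip decay of `g_v` ([Gr26] Lemma 2.2) -/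

/-- Real and imaginary part of `(ρ − ½)/i`: `Re = Im ρ`, `Im = ½ − Re ρ`. [folklore] -/
private theorem stripPoint_re_im (ρ : ℂ) :
    ((ρ - 1 / 2) / I).re = ρ.im ∧ ((ρ - 1 / 2) / I).im = 1 / 2 - ρ.re := by
  rw [Complex.div_I]
  constructor
  · simp
  · simp

/-- A constant dominating `g_v` on a strip is nonnegative. [folklore] -/
private theorem decayConst_nonneg {a C : ℝ} (ha : 0 ≤ a)
    (hC : ∀ z : ℂ, |z.im| ≤ a → ‖testFunction c N v z‖ ≤ C / (1 + |z.re|) ^ 2) : 0 ≤ C := by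
  have h := hC 0 (by simpa using ha)
  simp only [Complex.zero_re, abs_zero, add_zero, one_pow, div_one] at h
  exact (norm_nonneg _).trans h

/-- `(1 + |x|)² ≥ 1 + x²`. [folklore] -/
private theorem one_add_sq_le_sq (x : ℝ) : 1 + x ^ 2 ≤ (1 + |x|) ^ 2 := by
  nlinarith [abs_nonneg x, sq_abs x]

/-- **Absolute convergence of the zero side** for the transported test function, from the strip
decay of `g_v` ([Gr26] Lemma 2.2: «the Riemann–von Mangoldt local zero count … gives absolute
convergence of the zero sum») — here via the tree's `Σ_ρ m(ρ)/(1+γ²) < ∞`.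
[cite: Groskin2026, Lemma 2.2 (p. 4–5)] -/
theorem summable_norm_zeroSide_transport (hc : 1 < c) (N : ℕ)
    (v : Fin (N + 1) → ℝ) :
    Summable fun ρ : ZetaZeros.riemannZetaNontrivialZeros ↦
      ‖(riemannZetaZeroOrder (ρ : ℂ) : ℂ) *
        weilMellin (fun t : ℝ ↦ fourierWeight c N v (t / (2 * π)) / (2 * π)) ρ‖ := by
  obtain ⟨C, hC⟩ := (lemma_2_2_holds c hc N v).2 (1 / 2)
  have hC0 : 0 ≤ C := decayConst_nonneg (by norm_num) hC
  have hS : Summable fun ρ : ZetaZeros.riemannZetaNontrivialZeros ↦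
      C * ((riemannZetaZeroOrder (ρ : ℂ) : ℝ) / (1 + (ρ : ℂ).im ^ 2)) :=
    ZetaZeroSum.summable_zeroOrder_div_one_add_sq.mul_left C
  refine Summable.of_nonneg_of_le (fun _ ↦ norm_nonneg _) (fun ρ ↦ ?_) hS
  have hρ := ρ.2
  have h0 := ZetaZeros.riemannZetaNontrivialZeros.re_pos hρ
  have h1 := ZetaZeros.riemannZetaNontrivialZeros.re_lt_one hρ
  have hm : (0 : ℝ) ≤ riemannZetaZeroOrder (ρ : ℂ) := by
    exact_mod_cast riemannZetaZeroOrder_nonneg (ZetaZeros.riemannZetaNontrivialZeros.ne_one hρ)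
  obtain ⟨hre, him⟩ := stripPoint_re_im (ρ : ℂ)
  have hz : |(((ρ : ℂ) - 1 / 2) / I).im| ≤ 1 / 2 := by
    rw [him, abs_le]
    constructor <;> linarith
  have hb := hC _ hz
  rw [hre] at hb
  rw [weilMellin_transport hc, norm_mul, Complex.norm_intCast, abs_of_nonneg hm]
  have hsq : 0 < 1 + ((ρ : ℂ)).im ^ 2 := by positivity
  calc (riemannZetaZeroOrder (ρ : ℂ) : ℝ) * ‖testFunction c N v (((ρ : ℂ) - 1 / 2) / I)‖
      ≤ (riemannZetaZeroOrder (ρ : ℂ) : ℝ) * (C / (1 + |(ρ : ℂ).im|) ^ 2) :=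
        mul_le_mul_of_nonneg_left hb hm
    _ ≤ (riemannZetaZeroOrder (ρ : ℂ) : ℝ) * (C / (1 + (ρ : ℂ).im ^ 2)) := by
        gcongr
        exact one_add_sq_le_sq _
    _ = C * ((riemannZetaZeroOrder (ρ : ℂ) : ℝ) / (1 + (ρ : ℂ).im ^ 2)) := by ring

/-- `g_v` is continuous on the real line ([Gr26] Lemma 2.2: `g_v` is entire).
[cite: Groskin2026, Lemma 2.2 (p. 4)] -/
theorem continuous_testFunction_real (hc : 1 < c) (N : ℕ)
    (v : Fin (N + 1) → ℝ) : Continuous fun t : ℝ ↦ testFunction c N v t :=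
  (lemma_2_2_holds c hc N v).1.continuous.comp continuous_ofReal

/-- `(1 + |t|)^{-r}` written with `rpow` equals the real power for natural `r`. [folklore] -/
private theorem one_add_abs_rpow_neg_two (t : ℝ) :
    (1 + ‖t‖) ^ (-(2 : ℝ)) = 1 / (1 + |t|) ^ 2 := by
  rw [Real.norm_eq_abs, Real.rpow_neg (by positivity), one_div]
  norm_cast

/-- **`g_v ∈ L¹(ℝ)`** (decay `O((1+|t|)⁻²)` on the real line). [cite: Groskin2026, Lemma 2.2 (p. 4)] -/
theorem integrable_testFunction_real (hc : 1 < c) (N : ℕ)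
    (v : Fin (N + 1) → ℝ) : Integrable fun t : ℝ ↦ testFunction c N v t := by
  obtain ⟨C, hC⟩ := (lemma_2_2_holds c hc N v).2 0
  have hint : Integrable fun t : ℝ ↦ C * (1 + ‖t‖) ^ (-(2 : ℝ)) :=
    (integrable_one_add_norm (E := ℝ) (μ := volume)
      (by rw [Module.finrank_self]; norm_num)).const_mul C
  refine hint.mono' (continuous_testFunction_real hc N v).aestronglyMeasurable
    (Eventually.of_forall fun t ↦ ?_)
  have h := hC (t : ℂ) (by simp)
  simp only [Complex.ofReal_re] at h
  rw [one_add_abs_rpow_neg_two, mul_one_div]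
  exact h

/-- **Integrability of the archimedean integrand** `g_v(t) Re ψ(¼ + it/2)` ([Gr26] p. 6: «Lemma 2.2
and h₊(r) = O(log(2+|r|)) [24]»). [cite: Groskin2026, Theorem 2.5 (p. 6)] -/
theorem integrable_testFunction_mul_reDigamma (hc : 1 < c) (N : ℕ)
    (v : Fin (N + 1) → ℝ) :
    Integrable fun t : ℝ ↦ testFunction c N v t * ((Complex.digamma (1 / 4 + t / 2 * I)).re : ℂ) := by
  obtain ⟨C, hC⟩ := (lemma_2_2_holds c hc N v).2 0
  have hC0 : 0 ≤ C := decayConst_nonneg le_rfl hC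
  set A : ℝ := |reDigammaQuarter 0| + Real.log 7 + Real.log π with hA
  have hA0 : 0 ≤ A := by
    have h7 : 0 ≤ Real.log 7 := Real.log_nonneg (by norm_num)
    have hπ : 0 ≤ Real.log π := Real.log_nonneg (by linarith [Real.pi_gt_three])
    positivity
  have hint : Integrable fun t : ℝ ↦ C * (A + 2) * (1 + ‖t‖) ^ (-(3 / 2 : ℝ)) :=
    (integrable_one_add_norm (E := ℝ) (μ := volume)
      (by rw [Module.finrank_self]; norm_num)).const_mul (C * (A + 2))
  have hmeas : AEStronglyMeasurable
      (fun t : ℝ ↦ testFunction c N v t * ((Complex.digamma (1 / 4 + t / 2 * I)).re : ℂ)) volume := by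
    refine ((continuous_testFunction_real hc N v).mul ?_).aestronglyMeasurable
    exact continuous_ofReal.comp continuous_reDigammaQuarter
  refine hint.mono' hmeas (Eventually.of_forall fun t ↦ ?_)
  have h := hC (t : ℂ) (by simp)
  simp only [Complex.ofReal_re] at h
  have hψ : |reDigammaQuarter t| ≤ A + Real.log (1 + |t|) := abs_reDigammaQuarter_le_log t
  set u : ℝ := 1 + |t| with hu
  have hu1 : 1 ≤ u := by rw [hu]; linarith [abs_nonneg t]
  have hu0 : 0 < u := by linarith
  have hlog : Real.log u ≤ 2 * u ^ (1 / 2 : ℝ) := by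
    have := Real.log_le_rpow_div hu0.le (by norm_num : (0 : ℝ) < 1 / 2)
    linarith
  have hsqrt1 : 1 ≤ u ^ (1 / 2 : ℝ) := Real.one_le_rpow hu1 (by norm_num)
  have hnum : A + Real.log u ≤ (A + 2) * u ^ (1 / 2 : ℝ) := by nlinarith
  have hpow : u ^ (1 / 2 : ℝ) / u ^ 2 = u ^ (-(3 / 2 : ℝ)) := by
    rw [show (-(3 / 2 : ℝ)) = 1 / 2 - 2 by norm_num, Real.rpow_sub hu0, Real.rpow_two]
  rw [norm_mul, Complex.norm_real, Real.norm_eq_abs, Real.norm_eq_abs, ← hu]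
  change ‖testFunction c N v t‖ * |reDigammaQuarter t| ≤ C * (A + 2) * u ^ (-(3 / 2 : ℝ))
  calc ‖testFunction c N v t‖ * |reDigammaQuarter t|
      ≤ (C / u ^ 2) * (A + Real.log u) :=
        mul_le_mul h hψ (abs_nonneg _) (by positivity)
    _ ≤ (C / u ^ 2) * ((A + 2) * u ^ (1 / 2 : ℝ)) := by gcongr
    _ = C * (A + 2) * (u ^ (1 / 2 : ℝ) / u ^ 2) := by ring
    _ = C * (A + 2) * u ^ (-(3 / 2 : ℝ)) := by rw [hpow]

/-! ## §5 Fourier inversion at the origin: `∫_ℝ g_v = ĝ_v(0)` -/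

/-- `ĝ_v` has compact support. [cite: Groskin2026, Lemma 2.2 (p. 4)] -/
theorem hasCompactSupport_fourierWeight (hc : 1 < c) (N : ℕ) (v : Fin (N + 1) → ℝ) :
    HasCompactSupport (fourierWeight c N v) := by
  refine HasCompactSupport.intro (isCompact_Icc (a := -bandwidth c) (b := bandwidth c)) ?_
  intro ξ hξ
  have h := support_fourierWeight_subset hc (N := N) (v := v)
  by_contra hne
  exact hξ (Ioc_subset_Icc_self (h (Function.mem_support.2 hne)))

/-- The Fourier transform of `ĝ_v` (Mathlib's `𝓕`, kernel `e^{−2πiξw}`) is `g_v` on the real line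
(`g_v` is even). [cite: Groskin2026, §2.1 (p. 3)] -/
theorem fourier_fourierWeight (hc : 1 < c) (N : ℕ) (v : Fin (N + 1) → ℝ) (w : ℝ) :
    𝓕 (fourierWeight c N v) w = testFunction c N v w := by
  rw [Real.fourier_real_eq_integral_exp_smul, ← testFunction_neg hc, testFunction_eq_integral_mul hc]
  refine integral_congr_ae (Eventually.of_forall fun ξ ↦ ?_)
  beta_reduce
  rw [smul_eq_mul, mul_comm]
  congr 1
  push_cast
  ring_nf

/-- **`∫_ℝ g_v(r) dr = ĝ_v(0)`** (Fourier inversion at `0`; `ĝ_v` continuous and compactly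
supported, `g_v ∈ L¹`). [folklore] -/
private theorem integral_testFunction_real (hc : 1 < c) (N : ℕ)
    (v : Fin (N + 1) → ℝ) :
    ∫ t : ℝ, testFunction c N v t = fourierWeight c N v 0 := by
  have hcont := continuous_fourierWeight hc N v
  have hint : Integrable (fourierWeight c N v) :=
    hcont.integrable_of_hasCompactSupport (hasCompactSupport_fourierWeight hc N v)
  have hF : 𝓕 (fourierWeight c N v) = fun w : ℝ ↦ testFunction c N v w := by
    funext w
    exact fourier_fourierWeight hc N v w
  have hint' : Integrable (𝓕 (fourierWeight c N v)) := by
    rw [hF]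
    exact integrable_testFunction_real hc N v
  have h := hint.fourierInv_fourier_eq hint' (hcont.continuousAt (x := 0))
  rw [Real.fourierInv_eq', hF] at h
  simpa using h

/-! ## §6 The archimedean term -/

/-- **Transport of the archimedean term**:
`(1/2π)∫ ĝ(½+it) Re ψ(¼+it/2) dt − g(0) log π = (1/2π) ∫_ℝ h₊(r) g_v(r) dr`.
[cite: Groskin2026, Theorem 2.5 (p. 6), «(1/2π)∫ h₊(r) g_v(r) dr»] -/
theorem weilArchTerm_transport (hc : 1 < c) (N : ℕ) (v : Fin (N + 1) → ℝ) :
    weilArchTerm (fun t : ℝ ↦ fourierWeight c N v (t / (2 * π)) / (2 * π)) =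
      (1 / (2 * π)) * ∫ r : ℝ, (hPlus r : ℂ) * testFunction c N v r := by
  rw [weilArchTerm_eq]
  simp_rw [weilMellin_transport_half hc]
  have hA := integrable_testFunction_mul_reDigamma hc N v
  have hB := integrable_testFunction_real hc N v
  have h0 := integral_testFunction_real hc N v
  have hsplit : (fun r : ℝ ↦ (hPlus r : ℂ) * testFunction c N v r) = fun r : ℝ ↦
      testFunction c N v r * ((Complex.digamma (1 / 4 + r / 2 * I)).re : ℂ) -
        (Real.log π : ℂ) * testFunction c N v r := by
    funext r
    simp only [hPlus, reDigammaQuarter]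
    push_cast
    ring
  rw [hsplit, integral_sub hA (hB.const_mul _), integral_const_mul, h0]
  simp only [zero_div]
  ring

/-! ## §7 The door: Theorem 2.5 (zero side) from its source side and Lemma 2.2 -/

/-- **The Weil functional of the transported test function is the source side of Theorem 2.5**:
`W(g) = −(1/π)Σ_{q≤⌊c⌋} Λ(q)q^{-½} ĝ_v(log q/2π) + 2g_v(i/2) + (1/2π)∫ h₊ g_v`.
[cite: Groskin2026, Theorem 2.5 (p. 6)] -/
theorem weilFunctional_transport (hc : 1 < c) (N : ℕ) (v : Fin (N + 1) → ℝ) :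
    weilFunctional (fun t : ℝ ↦ fourierWeight c N v (t / (2 * π)) / (2 * π)) =
      -(1 / π) * (∑ q ∈ Finset.range (⌊c⌋₊ + 1),
          ((ArithmeticFunction.vonMangoldt q / Real.sqrt q : ℝ) : ℂ) *
            fourierWeight c N v (Real.log q / (2 * π))) +
        2 * testFunction c N v (I / 2) +
        (1 / (2 * π)) * ∫ r : ℝ, (hPlus r : ℂ) * testFunction c N v r := by
  rw [weilFunctional, weilPolarTerm_transport hc, weilPrimeTerm_transport hc,
    weilArchTerm_transport hc]
  ring

/-- **The explicit formula for `g_v`**: `Σ_ρ m(ρ) g_v((ρ − ½)/i)` converges absolutely and sums to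
`W(g)` — the tree's `explicit_formula_continuous` applied to the transported test function.
[cite: Groskin2026, Theorem 2.5 (p. 6), «for every test function in the class of Lemma 2.2»] -/
theorem hasSum_zeros_transport (hc : 1 < c) (N : ℕ) (v : Fin (N + 1) → ℝ) :
    HasSum (fun ρ : ZetaZeros.riemannZetaNontrivialZeros ↦
        (riemannZetaZeroOrder (ρ : ℂ) : ℂ) * testFunction c N v (((ρ : ℂ) - 1 / 2) / I))
      (weilFunctional (fun t : ℝ ↦ fourierWeight c N v (t / (2 * π)) / (2 * π))) := by
  have hZ := summable_norm_zeroSide_transport hc N v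
  have hA : Integrable fun t : ℝ ↦
      weilMellin (fun t : ℝ ↦ fourierWeight c N v (t / (2 * π)) / (2 * π)) (1 / 2 + t * I) *
        ((Complex.digamma (1 / 4 + t / 2 * I)).re : ℂ) := by
    simp_rw [weilMellin_transport_half hc]
    exact integrable_testFunction_mul_reDigamma hc N v
  have hEF := explicit_formula_continuous (continuous_transport hc N v)
    (hasCompactSupport_transport hc N v) hZ hA
  have h2 := hasWeilZeroSide_tsum hZ
  have heq := tendsto_nhds_unique h2 hEF
  have hsum := hZ.of_norm.hasSum
  rw [heq] at hsum
  refine hsum.congr_fun fun ρ ↦ ?_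
  rw [weilMellin_transport hc]

end ZeroSide

open ZeroSide in
/-- **[Gr26] Theorem 2.5, ZERO SIDE, from its SOURCE side**: if
`⟨v, Q_∞ v⟩ = −(1/π)Σ_{q≤c}Λ(q)q^{-½}ĝ_v(log q/2π) + 2g_v(i/2) + (1/2π)∫h₊g_v` (`theorem_2_5'`), then
`⟨v, Q_∞ v⟩ = Σ_{z ∈ Z*_ζ} g_v(z)` with multiplicity, absolutely convergent — by the Guinand–Weil
explicit formula of the tree (`explicit_formula_continuous`) and [Gr26] Lemma 2.2 (tree theorem
`lemma_2_2_holds`). [cite: Groskin2026, Theorem 2.5 (p. 6)] -/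
theorem theorem_2_5_of (h25' : theorem_2_5') : theorem_2_5 := by
  intro c hc N v
  have h := hasSum_zeros_transport hc N v
  rwa [weilFunctional_transport hc, ← h25' c hc N v] at h

/-- **[Gr26] Theorem 2.5 (finite Guinand–Weil dictionary), ZERO SIDE — DISCHARGED**: for `c > 1`,
`N ≥ 0` and every real `v`, `⟨v, Q_∞ v⟩ = Σ_{z ∈ Z*_ζ} g_v(z)` with multiplicity (an absolutely
convergent `HasSum` over the tree's non-trivial zeros, weights `riemannZetaZeroOrder`), from the door
`theorem_2_5_of` (the tree's Guinand–Weil explicit formula `explicit_formula_continuous` applied to the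
transported test function) and the SOURCE side `theorem_2_5'_holds` (cc-t9 g4, over cc-t11 g4's
`lemma_2_1_limit_holds`, cc-t4 g5's `lemma_2_2_holds`, cc-t6 g5's `hPlus_le_log_sub`, rh-lit-frontier-1's
`lemma_2_3_holds`). An explicit formula is an identity valid wherever the zeros are: nothing here bears
on the truth of RH. [cite: Groskin2026, Theorem 2.5 (p. 6)] -/
theorem theorem_2_5_holds : theorem_2_5 := theorem_2_5_of theorem_2_5'_holds

end Groskin2026

end Literature.NumberTheory.LFunctions

end
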